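import Summits.AtomisticToContinuum.FouriersLaw.Theorems.PhononMeanFreePathIncoherentBoundedCorrelationDecay
import Mathlib.Analysis.Calculus.LineDeriv.IntegrationByParts

/-!
# `PhononMeanFreePath.IncoherentBounded` — statics: `Cov_{μ_T}(p_i², H) = T²` by Stein's identity with an exponential weight

Helper file for item `stmt-AtomisticToContinuum-11815` (support `IncoherentBounded`, route `PhononMeanFreePath`,
sub-problem `FouriersLaw`), part 2 of the ZEROTH-MOMENT SUM RULE (file `…IncoherentBoundedSumRule`). For EVERY chain
`pinnedChain ω₂ lam β γ` (`ω₂ > 0`, `lam, β ≥ 0`) and its Gibbs measure `μ_T = Z⁻¹ e^{-H/T} dq dp` at `T > 0`: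

* `stein_momentum_exp` — Stein's identity `∫ p_i F dμ_T = T ∫ ∂_{p_i}F dμ_T` for observables with `|F|, |∂_{p_i}F|,
  |p_i F| ≤ A e^{θH}`, `θ < 1/T` (the tree's `stein_momentum` covers polynomial growth `(1+‖x‖²)²` only, which is too
  small for `F = p_i H` when the potentials are quartic);
* `integral_kinObs_mul_hamiltonian` — **`∫ (p_i² - T) H dμ_T = T²`** (`F = p_i H`, `∂_{p_i}F = H + p_i²`, and
  equipartition `∫ p_i² dμ_T = T`, itself Stein with `F = p_i`): the static value `S(0)` of the sum rule.

No definitions; nothing here closes an item.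
-/

noncomputable section

open MeasureTheory ProbabilityTheory Filter Topology Set
open scoped NNReal ENNReal
open Literature.MathematicalPhysics.KineticTheory.HeatConduction
open Literature.MathematicalPhysics.KineticTheory Literature.Probability.Process OscillatorChain
open Summit.AtomisticToContinuum.FouriersLaw.Theorems.SubdiffusiveBondHeat

namespace Summit.AtomisticToContinuum.FouriersLaw.Theorems.IncoherentBounded

/-! ## 2. Statics: `Cov_{μ_T}(p_i², H) = T²` (Stein's identity with an exponential weight) -/

section Statics

variable {ω₂ lam β γ : ℝ} (hω : 0 < ω₂) (hl : 0 ≤ lam) (hβ : 0 ≤ β) {n : ℕ} {T : ℝ} (hT : 0 < T)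
include hω hl hβ hT

/-- **Stein's identity in a momentum direction, exponential class**: for `F` differentiable along `e_{p_i}` with
derivative `F'`, and `|F|, |F'|, |p_i F| ≤ A e^{θH}` with `θ < 1/T`: `∫ p_i F dμ_T = T ∫ F' dμ_T` (the momenta are exactly
Gaussian under `μ_T`, for every chain of the family). [folklore] -/
theorem stein_momentum_exp (i : Fin n) {F F' : PhaseSpace n → ℝ} (hFc : Continuous F) (hF'c : Continuous F')
    (hF : ∀ x, HasLineDerivAt ℝ F (F' x) x ((0, Pi.single i 1) : PhaseSpace n)) {θ A : ℝ} (hθ : θ < 1 / T)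
    (hA : ∀ x, |F x| ≤ A * Real.exp (θ * (pinnedChain ω₂ lam β γ).hamiltonian n x))
    (hA' : ∀ x, |F' x| ≤ A * Real.exp (θ * (pinnedChain ω₂ lam β γ).hamiltonian n x))
    (hAp : ∀ x, |x.2 i * F x| ≤ A * Real.exp (θ * (pinnedChain ω₂ lam β γ).hamiltonian n x)) :
    ∫ x, x.2 i * F x ∂((pinnedChain ω₂ lam β γ).gibbsMeasure n T) =
      T * ∫ x, F' x ∂((pinnedChain ω₂ lam β γ).gibbsMeasure n T) := by
  set P := pinnedChain ω₂ lam β γ with hP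
  haveI : (volume : Measure (PhaseSpace n)).IsAddHaarMeasure :=
    @Measure.prod.instIsAddHaarMeasure (Fin n → ℝ) _ _ _ (Fin n → ℝ) _ _ _ volume volume _ _ _ _ _ _
  have hρ' : ∀ x, HasLineDerivAt ℝ (P.gibbsDensity n T) (-(x.2 i / T) * P.gibbsDensity n T x) x
      ((0, Pi.single i 1) : PhaseSpace n) := fun x =>
    P.hasLineDerivAt_gibbsDensity (P.hasLineDerivAt_hamiltonian_unitP n x i)
  have hw := pinnedChain_integrable_exp_mul_gibbsDensity hω hl hβ γ n hT hθ
  have hρc : Continuous (P.gibbsDensity n T) := pinnedChain_continuous_gibbsDensity ω₂ lam β γ n T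
  have hdom : ∀ {G : PhaseSpace n → ℝ}, Continuous G →
      (∀ x, |G x| ≤ A * Real.exp (θ * P.hamiltonian n x)) → Integrable (fun x => G x * P.gibbsDensity n T x) := by
    intro G hGc hGb
    refine (hw.const_mul A).mono' (hGc.mul hρc).aestronglyMeasurable (Eventually.of_forall fun x => ?_)
    have hρ0 : 0 < P.gibbsDensity n T x := P.gibbsDensity_pos n T x
    rw [Real.norm_eq_abs, abs_mul, abs_of_pos hρ0, ← mul_assoc]
    exact mul_le_mul_of_nonneg_right (hGb x) hρ0.le
  have hIF : Integrable (fun x => F x * P.gibbsDensity n T x) := hdom hFc hA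
  have hIF' : Integrable (fun x => F' x * P.gibbsDensity n T x) := hdom hF'c hA'
  have hIFp : Integrable (fun x => x.2 i * F x * P.gibbsDensity n T x) :=
    hdom ((by fun_prop : Continuous fun x : PhaseSpace n => x.2 i).mul hFc) hAp
  have e := integral_bilinear_hasLineDerivAt_right_eq_neg_left_of_integrable
    (μ := (volume : Measure (PhaseSpace n))) (B := ContinuousLinearMap.mul ℝ ℝ)
    (f := F) (f' := F') (g := P.gibbsDensity n T) (g' := fun x => -(x.2 i / T) * P.gibbsDensity n T x)
    (v := ((0, Pi.single i 1) : PhaseSpace n)) ?_ ?_ ?_ (fun x _ => hF x) (fun x _ => hρ' x)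
  · simp only [ContinuousLinearMap.mul_apply'] at e
    have e2 : ∫ x, x.2 i * F x * P.gibbsDensity n T x = T * ∫ x, F' x * P.gibbsDensity n T x := by
      have e3 : ∫ x, F x * (-(x.2 i / T) * P.gibbsDensity n T x) =
          -(T⁻¹) * ∫ x, x.2 i * F x * P.gibbsDensity n T x := by
        rw [← integral_const_mul]
        refine integral_congr_ae (Eventually.of_forall fun x => ?_)
        simp only [div_eq_mul_inv]
        ring
      rw [e3] at e
      have hT0 : T ≠ 0 := hT.ne'
      field_simp at e
      linarith
    rw [P.integral_gibbsMeasure, P.integral_gibbsMeasure (fun x => F' x), e2]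
    ring
  · simp only [ContinuousLinearMap.mul_apply']
    exact hIF'
  · simp only [ContinuousLinearMap.mul_apply']
    have : (fun x => F x * (-(x.2 i / T) * P.gibbsDensity n T x)) =
        fun x => -(T⁻¹) * (x.2 i * F x * P.gibbsDensity n T x) := by
      funext x; simp only [div_eq_mul_inv]; ring
    rw [this]
    exact hIFp.const_mul _
  · simp only [ContinuousLinearMap.mul_apply']
    exact hIF

omit hω hl hβ hT in
/-- `H ≤ e^{ϑH}/ϑ` for `ϑ > 0`. [folklore] -/
theorem hamiltonian_le_exp {ϑ : ℝ} (hϑ : 0 < ϑ) (x : PhaseSpace n) :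
    (pinnedChain ω₂ lam β γ).hamiltonian n x ≤ Real.exp (ϑ * (pinnedChain ω₂ lam β γ).hamiltonian n x) / ϑ := by
  have hexp := Real.add_one_le_exp (ϑ * (pinnedChain ω₂ lam β γ).hamiltonian n x)
  rw [le_div_iff₀ hϑ]; nlinarith

/-- **`∫ (p_i² - T) H dμ_T = T²`**: the energy covariance of a kinetic temperature reading is `Cov(p_i², p_i²/2) = T²`
(Stein with `F = p_i H`, `F' = H + p_i²`: `∫ p_i² H dμ_T = T ∫ (H + p_i²) dμ_T`, and `∫ p_i² dμ_T = T`). [folklore] -/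
theorem integral_kinObs_mul_hamiltonian (i : Fin n) :
    ∫ x, (x.2 i ^ 2 - T) * (pinnedChain ω₂ lam β γ).hamiltonian n x ∂((pinnedChain ω₂ lam β γ).gibbsMeasure n T) =
      T ^ 2 := by
  set P := pinnedChain ω₂ lam β γ with hP
  set μ := P.gibbsMeasure n T with hμ
  haveI : IsProbabilityMeasure μ := pinnedChain_isProbabilityMeasure_gibbsMeasure hω hl hβ γ n hT
  set ϑ : ℝ := 1 / (4 * T) with hϑ
  have hϑ0 : 0 < ϑ := by positivity
  have hθ1 : 2 * ϑ < 1 / T := by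
    rw [hϑ, show 2 * (1 / (4 * T)) = 1 / (2 * T) by field_simp; ring, div_lt_div_iff₀ (by positivity) hT]
    nlinarith
  have hϑ1 : ϑ < 1 / T := by linarith
  have hH0 : ∀ x, 0 ≤ P.hamiltonian n x := fun x => pinnedChain_hamiltonian_nonneg hω.le hl hβ γ n x
  have hHc : Continuous (P.hamiltonian n) := pinnedChain_continuous_hamiltonian ω₂ lam β γ n
  have hpc : Continuous fun x : PhaseSpace n => x.2 i := by fun_prop
  -- pointwise exponential bounds
  have hp1 : ∀ x, |x.2 i| ≤ (1 / 2 + 1 / ϑ) * Real.exp (ϑ * P.hamiltonian n x) := fun x =>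
    abs_momentum_le_exp hω hl hβ hϑ0 x i
  have hp2 : ∀ x, x.2 i ^ 2 ≤ (2 / ϑ) * Real.exp (ϑ * P.hamiltonian n x) := fun x =>
    sq_momentum_le_exp (γ := γ) hω hl hβ hϑ0 x i
  have hHe : ∀ x, P.hamiltonian n x ≤ Real.exp (ϑ * P.hamiltonian n x) / ϑ := fun x =>
    hamiltonian_le_exp (γ := γ) hϑ0 x
  have hee : ∀ x, Real.exp (ϑ * P.hamiltonian n x) * Real.exp (ϑ * P.hamiltonian n x) =
      Real.exp (2 * ϑ * P.hamiltonian n x) := fun x => by rw [← Real.exp_add]; ring_nf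
  have he1 : ∀ x, Real.exp (ϑ * P.hamiltonian n x) ≤ Real.exp (2 * ϑ * P.hamiltonian n x) := fun x =>
    Real.exp_le_exp.2 (by nlinarith [hH0 x])
  set A : ℝ := (1 / 2 + 1 / ϑ) / ϑ + 3 / ϑ + 2 / ϑ ^ 2 + (1 / 2 + 1 / ϑ) + 1 with hA
  have hq1 : 0 ≤ (1 / 2 + 1 / ϑ) / ϑ := by positivity
  have hq2 : 0 ≤ 3 / ϑ := by positivity
  have hq3 : 0 ≤ 2 / ϑ ^ 2 := by positivity
  have hq4 : 0 ≤ 1 / 2 + 1 / ϑ := by positivity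
  have hA1 : (1 / 2 + 1 / ϑ) / ϑ ≤ A := by rw [hA]; linarith
  have hA2 : 3 / ϑ ≤ A := by rw [hA]; linarith
  have hA3 : 2 / ϑ ^ 2 ≤ A := by rw [hA]; linarith
  have hA4 : 1 / 2 + 1 / ϑ ≤ A := by rw [hA]; linarith
  have hA5 : 1 ≤ A := by rw [hA]; linarith
  have hb1 : ∀ x, |x.2 i * P.hamiltonian n x| ≤ A * Real.exp (2 * ϑ * P.hamiltonian n x) := fun x => by
    rw [abs_mul, abs_of_nonneg (hH0 x)]
    calc |x.2 i| * P.hamiltonian n x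
        ≤ ((1 / 2 + 1 / ϑ) * Real.exp (ϑ * P.hamiltonian n x)) * (Real.exp (ϑ * P.hamiltonian n x) / ϑ) :=
          mul_le_mul (hp1 x) (hHe x) (hH0 x) (by positivity)
      _ = (1 / 2 + 1 / ϑ) / ϑ * Real.exp (2 * ϑ * P.hamiltonian n x) := by rw [← hee x]; ring
      _ ≤ A * Real.exp (2 * ϑ * P.hamiltonian n x) := mul_le_mul_of_nonneg_right hA1 (Real.exp_pos _).le
  have hb2 : ∀ x, |P.hamiltonian n x + x.2 i * x.2 i| ≤ A * Real.exp (2 * ϑ * P.hamiltonian n x) := fun x => by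
    rw [abs_of_nonneg (by nlinarith [hH0 x, mul_self_nonneg (x.2 i)])]
    calc P.hamiltonian n x + x.2 i * x.2 i
        ≤ Real.exp (ϑ * P.hamiltonian n x) / ϑ + (2 / ϑ) * Real.exp (ϑ * P.hamiltonian n x) := by
          rw [← sq]; exact add_le_add (hHe x) (hp2 x)
      _ = 3 / ϑ * Real.exp (ϑ * P.hamiltonian n x) := by ring
      _ ≤ A * Real.exp (2 * ϑ * P.hamiltonian n x) :=
          mul_le_mul hA2 (he1 x) (Real.exp_pos _).le (le_trans (by positivity) hA2)
  have hb3 : ∀ x, |x.2 i * (x.2 i * P.hamiltonian n x)| ≤ A * Real.exp (2 * ϑ * P.hamiltonian n x) := fun x => by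
    rw [← mul_assoc, ← sq, abs_mul, abs_of_nonneg (sq_nonneg _), abs_of_nonneg (hH0 x)]
    calc x.2 i ^ 2 * P.hamiltonian n x
        ≤ ((2 / ϑ) * Real.exp (ϑ * P.hamiltonian n x)) * (Real.exp (ϑ * P.hamiltonian n x) / ϑ) :=
          mul_le_mul (hp2 x) (hHe x) (hH0 x) (by positivity)
      _ = 2 / ϑ ^ 2 * Real.exp (2 * ϑ * P.hamiltonian n x) := by rw [← hee x]; ring
      _ ≤ A * Real.exp (2 * ϑ * P.hamiltonian n x) := mul_le_mul_of_nonneg_right hA3 (Real.exp_pos _).le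
  -- the line derivative of `p_i H`
  have hline : ∀ x : PhaseSpace n, HasLineDerivAt ℝ (fun x : PhaseSpace n => x.2 i * P.hamiltonian n x)
      (P.hamiltonian n x + x.2 i * x.2 i) x ((0, Pi.single i 1) : PhaseSpace n) := by
    intro x
    have hH := P.hasLineDerivAt_hamiltonian_unitP n x i
    unfold HasLineDerivAt at hH ⊢
    have h1 : HasDerivAt (fun t : ℝ => (x + t • ((0, Pi.single i 1) : PhaseSpace n)).2 i) 1 0 := by
      have key : (fun t : ℝ => (x + t • ((0, Pi.single i 1) : PhaseSpace n)).2 i) = fun t => x.2 i + t := by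
        funext t; simp
      rw [key]
      exact (hasDerivAt_id (0 : ℝ)).const_add _
    have h := h1.mul hH
    simp only [zero_smul, add_zero, one_mul] at h
    exact h
  -- Stein
  have hS := stein_momentum_exp hω hl hβ hT i (F := fun x => x.2 i * P.hamiltonian n x)
    (F' := fun x => P.hamiltonian n x + x.2 i * x.2 i) (hpc.mul hHc) (hHc.add (hpc.mul hpc)) hline hθ1 hb1 hb2 hb3
  -- integrability under `μ_T`
  have hw : Integrable (fun x => Real.exp (2 * ϑ * P.hamiltonian n x)) μ :=
    pinnedChain_integrable_exp_mul_hamiltonian_gibbsMeasure hω hl hβ γ n hT hθ1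
  have hIH : Integrable (P.hamiltonian n) μ := by
    refine integrable_of_abs_le_exp hw hHc (C := A) fun x => ?_
    rw [abs_of_nonneg (hH0 x)]
    calc P.hamiltonian n x ≤ Real.exp (ϑ * P.hamiltonian n x) / ϑ := hHe x
      _ = 1 / ϑ * Real.exp (ϑ * P.hamiltonian n x) := by ring
      _ ≤ A * Real.exp (2 * ϑ * P.hamiltonian n x) :=
          mul_le_mul (le_trans (by rw [div_le_div_iff_of_pos_right hϑ0]; norm_num) hA2) (he1 x)
            (Real.exp_pos _).le (le_trans (by positivity) hA2)
  have hIp2 : Integrable (fun x : PhaseSpace n => x.2 i * x.2 i) μ := by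
    refine integrable_of_abs_le_exp hw (hpc.mul hpc) (C := A) fun x => ?_
    rw [← sq, abs_of_nonneg (sq_nonneg _)]
    calc x.2 i ^ 2 ≤ (2 / ϑ) * Real.exp (ϑ * P.hamiltonian n x) := hp2 x
      _ ≤ A * Real.exp (2 * ϑ * P.hamiltonian n x) :=
          mul_le_mul (le_trans (by rw [div_le_div_iff_of_pos_right hϑ0]; norm_num) hA2) (he1 x)
            (Real.exp_pos _).le (le_trans (by positivity) hA2)
  have hIpH : Integrable (fun x : PhaseSpace n => x.2 i ^ 2 * P.hamiltonian n x) μ := by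
    refine integrable_of_abs_le_exp hw ((hpc.pow 2).mul hHc) (C := A) fun x => ?_
    have := hb3 x
    rwa [← mul_assoc, ← sq] at this
  have hT2 : ∫ x, x.2 i * x.2 i ∂μ = T := by
    -- equipartition, again by Stein (`F = p_i`, `F' = 1`)
    have hline1 : ∀ x : PhaseSpace n, HasLineDerivAt ℝ (fun x : PhaseSpace n => x.2 i) 1 x
        ((0, Pi.single i 1) : PhaseSpace n) := by
      intro x
      unfold HasLineDerivAt
      have key : (fun t : ℝ => (x + t • ((0, Pi.single i 1) : PhaseSpace n)).2 i) = fun t => x.2 i + t := by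
        funext t; simp
      rw [key]
      exact (hasDerivAt_id (0 : ℝ)).const_add _
    have hE1 : ∀ x, 1 ≤ Real.exp (2 * ϑ * P.hamiltonian n x) := fun x =>
      Real.one_le_exp (by nlinarith [hH0 x])
    have hc1 : ∀ x : PhaseSpace n, |x.2 i| ≤ A * Real.exp (2 * ϑ * P.hamiltonian n x) := fun x =>
      (hp1 x).trans (mul_le_mul hA4 (he1 x) (Real.exp_pos _).le (le_trans hq4 hA4))
    have hc2 : ∀ x : PhaseSpace n, |(1 : ℝ)| ≤ A * Real.exp (2 * ϑ * P.hamiltonian n x) := fun x => by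
      rw [abs_one]
      calc (1 : ℝ) = 1 * 1 := (mul_one _).symm
        _ ≤ A * Real.exp (2 * ϑ * P.hamiltonian n x) := mul_le_mul hA5 (hE1 x) zero_le_one (le_trans zero_le_one hA5)
    have hc3 : ∀ x : PhaseSpace n, |x.2 i * x.2 i| ≤ A * Real.exp (2 * ϑ * P.hamiltonian n x) := fun x => by
      rw [← sq, abs_of_nonneg (sq_nonneg _)]
      calc x.2 i ^ 2 ≤ (2 / ϑ) * Real.exp (ϑ * P.hamiltonian n x) := hp2 x
        _ ≤ A * Real.exp (2 * ϑ * P.hamiltonian n x) :=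
            mul_le_mul (le_trans (by rw [div_le_div_iff_of_pos_right hϑ0]; norm_num) hA2) (he1 x)
              (Real.exp_pos _).le (le_trans (by positivity) hA2)
    have hS1 := stein_momentum_exp hω hl hβ hT i (F := fun x => x.2 i) (F' := fun _ => (1 : ℝ)) hpc
      continuous_const hline1 hθ1 hc1 hc2 hc3
    rw [integral_const, probReal_univ, one_smul, mul_one] at hS1
    exact hS1
  -- assemble
  have e1 : ∫ x, (x.2 i ^ 2 - T) * P.hamiltonian n x ∂μ = (∫ x, x.2 i ^ 2 * P.hamiltonian n x ∂μ) - T * ∫ x, P.hamiltonian n x ∂μ := by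
    have : (fun x : PhaseSpace n => (x.2 i ^ 2 - T) * P.hamiltonian n x) =
        fun x => x.2 i ^ 2 * P.hamiltonian n x - T * P.hamiltonian n x := funext fun x => by ring
    rw [this, integral_sub hIpH (hIH.const_mul T), integral_const_mul]
  have e2 : ∫ x, x.2 i ^ 2 * P.hamiltonian n x ∂μ = ∫ x, x.2 i * (x.2 i * P.hamiltonian n x) ∂μ :=
    integral_congr_ae (Eventually.of_forall fun x => by simp only; ring)
  rw [e1, e2, hS, integral_add hIH hIp2, hT2]
  ring

end Statics

end Summit.AtomisticToContinuum.FouriersLaw.Theorems.IncoherentBounded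

end
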